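/-
Copyright (c) 2026. Released under Apache 2.0 license as described in the file LICENSE.
-/
import Summits.RiemannHypothesis.RiemannHypothesis.Theorems.LiDirichletKernelStructure
import HarnessLib

/-!
# KERNEL LINEAGE K-χ — TREND DOMINANCE: which part of `Re λ_χ(n) = lb_χ(n) + lt_χ(n)` carries the sign, `n ≤ 48`

RH-FREE DATA (finite certified ranges; no GRH-to-height input; 0 kit).  bears_on: LADDER-RH L-D (COLUMN 4 LI, DATA
rung; Dirichlet rows — STRUCTURE of the arithmetic part across `χ`; consumers `LiCriterionDirichlet.lean:95/194/305`).
WHAT THIS IS NOT: `lb_χ(n) ≫ |lt_χ(n)|` for ALL `n` would give Li's criterion and is GRH-strength — NOT claimed; a finite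
certified range is numbers, not evidence; nothing here bears on the truth of RH/GRH.

By T-D2s (`liDirichletSplit_holds`) `Re λ_χ(n) = lb_χ(n) + lt_χ(n)` with the ARCHIMEDEAN TREND `lb_χ = charLiTrend χ`
(Li functional of the Gamma factor; depends on `q` and the parity only) and the ARITHMETIC PART `lt_χ = charLiOsc χ`
(Li functional of `log L(s, χ)`).  The kernel-certified table (all 37 primitive `χ` of conductor `≤ 13`) says:

* `charLiTrend_gt_three_mul_abs_charLiOsc` — from `n = 4` on the trend dominates: `3·|lt_χ(n)| < lb_χ(n)` (`4 ≤ n ≤ 48`);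
  `charLiTrend_gt_five_mul_abs_charLiOsc` — `5·|lt_χ(n)| < lb_χ(n)` for `7 ≤ n ≤ 48`;
  `charLiTrend_gt_ten_mul_abs_charLiOsc` — `10·|lt_χ(n)| < lb_χ(n)` for `17 ≤ n ≤ 48`
  (thresholds sharp for the table: `n = 3` fails `c = 3` at `χ = 3.2`, `n = 6` fails `c = 5` at `13.6`, `n = 16` fails
  `c = 10` at `11.10`).  So `Re λ_χ(n) > 0` for `4 ≤ n ≤ 48` is TREND-CARRIED (`liCoeffCharRe_pos_of_dominance`).
* At `n = 1` the trend is NEGATIVE for every EVEN character modulo `q ∈ {5, 7, 8, 9, 11, 12, 13}` and for every ODD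
  character modulo `q ∈ {3, 4, 5}` (`charLiTrend_one_neg_of_even`, `charLiTrend_one_neg_of_odd`: facts about `ψ`,
  `lb_χ(1) = ½ log(q/π) + ½ ψ((1+a)/2)`, read off the certified trend rows; GRH-free AND `L`-free), positive for odd
  characters modulo `q ∈ {7, 8, 9, 11, 13}` (`charLiTrend_one_pos_of_odd`).  Hence for those 20 primitive characters the
  first Li coefficient is ARITHMETIC-CARRIED: `charLiOsc χ 1 > liCoeffCharRe χ 1 > 0 > charLiTrend χ 1`
  (`charLiOsc_one_gt_liCoeffCharRe_one_of_trend_neg` with `liCoeffCharRe_pos_of_isPrimitive_le_13`), i.e.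
  `Re (L′/L)(1, χ) = lt_χ(1)` exceeds `|lb_χ(1)|`.

Deciders: `domOK` over the 23 `classRows` tables (`allDomOK_true`, one `decide +kernel`) via the engine
`exists_classRows_of_isPrimitive`; the `n = 1` signs by `decide` on row 1 of the trend tables `trQ…`.
-/

set_option linter.dupNamespace false

namespace Summit.RiemannHypothesis.RiemannHypothesis.Theorems.LiDirichletKernel

open Literature.NumberTheory.LFunctions Literature.NumberTheory.LFunctions.LiDirichlet
open Summit.RiemannHypothesis.RiemannHypothesis.Theorems.LiTheory

/-! ## The dominance decider and its soundness -/

/-- `c`-dominance test on one row `(d, λ.lo, λ.hi, lt.lo, lt.hi)`: `(c+1)·lt.hi < λ.lo` and `(c−1)·(−lt.lo) < λ.lo`. -/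
def domRow (c : ℤ) (r : ℕ × ℤ × ℤ × ℤ × ℤ) : Bool :=
  decide ((c + 1) * r.2.2.2.2 < r.2.1) && decide ((c - 1) * (-r.2.2.2.1) < r.2.1)

/-- The dominance checks on one table: `c = 3` from row `4`, `c = 5` from row `7`, `c = 10` from row `17`. -/
def domOK (rows : RowTable) : Bool :=
  (List.range 48).all fun i ↦
    (decide (i + 1 < 4) || domRow 3 (rowOf rows (i + 1)))
    && (decide (i + 1 < 7) || domRow 5 (rowOf rows (i + 1)))
    && (decide (i + 1 < 17) || domRow 10 (rowOf rows (i + 1)))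

/-- All 23 tables pass the dominance checks. -/
def allDomOK : Bool := (List.range 14).all fun q ↦ (classRows q).all domOK

/-- Kernel evaluation of the checks. -/
theorem allDomOK_true : allDomOK = true := by decide +kernel

/-- Every tabulated row set passes `domOK`. -/
theorem domOK_of_mem {q : ℕ} (hq : q ≤ 13) {rows : RowTable} (h : rows ∈ classRows q) : domOK rows = true := by
  have hall := allDomOK_true
  unfold allDomOK at hall
  rw [List.all_eq_true] at hall
  have hq' := hall q (List.mem_range.2 (by omega))
  rw [List.all_eq_true] at hq'
  exact hq' rows h

/-- What `domOK rows = true` says at row `n`. -/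
theorem domOK_spec {rows : RowTable} (h : domOK rows = true) {n : ℕ} (hn : 1 ≤ n) (hn' : n ≤ 48) :
    (4 ≤ n → domRow 3 (rowOf rows n) = true) ∧ (7 ≤ n → domRow 5 (rowOf rows n) = true) ∧
      (17 ≤ n → domRow 10 (rowOf rows n) = true) := by
  unfold domOK at h
  rw [List.all_eq_true] at h
  have h' := h (n - 1) (List.mem_range.2 (by omega))
  rw [show n - 1 + 1 = n by omega] at h'
  simp only [Bool.and_eq_true, Bool.or_eq_true, decide_eq_true_eq] at h'
  obtain ⟨⟨h1, h2⟩, h3⟩ := h'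
  exact ⟨fun hle ↦ h1.resolve_left (by omega), fun hle ↦ h2.resolve_left (by omega),
    fun hle ↦ h3.resolve_left (by omega)⟩

/-- Soundness of the row test: if `x ∈ λ-row`, `y ∈ lt-row` (same digits) and `domRow c` passes (`c ≥ 1`), then
`c·|y| < x − y`. -/
theorem mul_abs_lt_sub_of_domRow {c : ℤ} (hc : 1 ≤ c) {x y : ℝ} {r : ℕ × ℤ × ℤ × ℤ × ℤ}
    (hx : InRow x r.1 r.2.1 r.2.2.1) (hy : InRow y r.1 r.2.2.2.1 r.2.2.2.2) (h : domRow c r = true) :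
    (c : ℝ) * |y| < x - y := by
  simp only [domRow, Bool.and_eq_true, decide_eq_true_eq] at h
  obtain ⟨h1, h2⟩ := h
  have hpos : (0 : ℝ) < 10 ^ r.1 := by positivity
  have hx1 : (r.2.1 : ℝ) / 10 ^ r.1 ≤ x := hx.1
  have hy1 : (r.2.2.2.1 : ℝ) / 10 ^ r.1 ≤ y := hy.1
  have hy2 : y ≤ (r.2.2.2.2 : ℝ) / 10 ^ r.1 := hy.2
  have h1' : ((c + 1) * r.2.2.2.2 : ℝ) / 10 ^ r.1 < (r.2.1 : ℝ) / 10 ^ r.1 := by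
    rw [div_lt_div_iff_of_pos_right hpos]; exact_mod_cast h1
  have h2' : ((c - 1) * (-r.2.2.2.1) : ℝ) / 10 ^ r.1 < (r.2.1 : ℝ) / 10 ^ r.1 := by
    rw [div_lt_div_iff_of_pos_right hpos]; exact_mod_cast h2
  have hc' : (1 : ℝ) ≤ c := by exact_mod_cast hc
  rcases le_or_gt 0 y with hy0 | hy0
  · rw [abs_of_nonneg hy0]
    have : ((c : ℝ) + 1) * y ≤ ((c + 1) * r.2.2.2.2 : ℝ) / 10 ^ r.1 := by
      rw [mul_div_assoc]; exact mul_le_mul_of_nonneg_left hy2 (by linarith)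
    linarith
  · rw [abs_of_neg hy0]
    have : ((c : ℝ) - 1) * (-y) ≤ ((c - 1) * (-r.2.2.2.1) : ℝ) / 10 ^ r.1 := by
      rw [mul_div_assoc]; exact mul_le_mul_of_nonneg_left (by rw [neg_div]; linarith) (by linarith)
    linarith

/-- The dominance statement for a primitive character, given the row test at level `c` from `n₀` on. -/
theorem charLiTrend_gt_mul_abs_of_dom {q : ℕ} [NeZero q] (hq : 2 ≤ q) (hq' : q ≤ 13) (χ : DirichletCharacter ℂ q)
    (hprim : χ.IsPrimitive) {c : ℤ} (hc : 1 ≤ c) {n : ℕ} (hn : 1 ≤ n) (hn' : n ≤ 48)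
    (hdom : ∀ rows ∈ classRows q, domRow c (rowOf rows n) = true) :
    (c : ℝ) * |charLiOsc χ n| < charLiTrend χ n := by
  obtain ⟨rows, hmem, hrows⟩ := exists_classRows_of_isPrimitive hq hq' χ hprim
  have hsplit := liDirichletSplit_holds q χ hprim (by omega) n hn
  have key := mul_abs_lt_sub_of_domRow hc (hrows.mem n hn hn').1 (hrows.mem n hn hn').2 (hdom rows hmem)
  linarith

/-! ## Trend dominance from `n = 4`, `7`, `17` -/

/-- **TREND DOMINANCE from `n = 4`**: `3·|lt_χ(n)| < lb_χ(n)` for every primitive character of conductor `2 ≤ q ≤ 13`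
and every `4 ≤ n ≤ 48` (sharp for the table: fails at `n = 3`, `χ = 3.2`).  RH-FREE DATA; no `∀ n` claim. -/
theorem charLiTrend_gt_three_mul_abs_charLiOsc {q : ℕ} [NeZero q] (hq : 2 ≤ q) (hq' : q ≤ 13)
    (χ : DirichletCharacter ℂ q) (hprim : χ.IsPrimitive) {n : ℕ} (hn : 4 ≤ n) (hn' : n ≤ 48) :
    3 * |charLiOsc χ n| < charLiTrend χ n := by
  have h := charLiTrend_gt_mul_abs_of_dom hq hq' χ hprim (c := 3) (by norm_num) (by omega) hn'
    (fun rows hmem ↦ (domOK_spec (domOK_of_mem hq' hmem) (by omega) hn').1 hn)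
  exact_mod_cast h

/-- **TREND DOMINANCE from `n = 7`**: `5·|lt_χ(n)| < lb_χ(n)` for every primitive character of conductor `2 ≤ q ≤ 13`
and every `7 ≤ n ≤ 48` (fails at `n = 6`, `χ = 13.6`).  RH-FREE DATA; no `∀ n` claim. -/
theorem charLiTrend_gt_five_mul_abs_charLiOsc {q : ℕ} [NeZero q] (hq : 2 ≤ q) (hq' : q ≤ 13)
    (χ : DirichletCharacter ℂ q) (hprim : χ.IsPrimitive) {n : ℕ} (hn : 7 ≤ n) (hn' : n ≤ 48) :
    5 * |charLiOsc χ n| < charLiTrend χ n := by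
  have h := charLiTrend_gt_mul_abs_of_dom hq hq' χ hprim (c := 5) (by norm_num) (by omega) hn'
    (fun rows hmem ↦ (domOK_spec (domOK_of_mem hq' hmem) (by omega) hn').2.1 hn)
  exact_mod_cast h

/-- **TREND DOMINANCE from `n = 17`**: `10·|lt_χ(n)| < lb_χ(n)` for every primitive character of conductor
`2 ≤ q ≤ 13` and every `17 ≤ n ≤ 48` (fails at `n = 16`, `χ = 11.10`).  RH-FREE DATA; no `∀ n` claim. -/
theorem charLiTrend_gt_ten_mul_abs_charLiOsc {q : ℕ} [NeZero q] (hq : 2 ≤ q) (hq' : q ≤ 13)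
    (χ : DirichletCharacter ℂ q) (hprim : χ.IsPrimitive) {n : ℕ} (hn : 17 ≤ n) (hn' : n ≤ 48) :
    10 * |charLiOsc χ n| < charLiTrend χ n := by
  have h := charLiTrend_gt_mul_abs_of_dom hq hq' χ hprim (c := 10) (by norm_num) (by omega) hn'
    (fun rows hmem ↦ (domOK_spec (domOK_of_mem hq' hmem) (by omega) hn').2.2 hn)
  exact_mod_cast h

/-- **`Re λ_χ(n) > 0` is TREND-CARRIED for `4 ≤ n ≤ 48`**: `Re λ_χ(n) ≥ lb_χ(n) − |lt_χ(n)| > (2/3)·lb_χ(n) > 0`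
(all 37 primitive characters of conductor `≤ 13`).  RH-FREE DATA; NOT Li's criterion. -/
theorem liCoeffCharRe_pos_of_dominance {q : ℕ} [NeZero q] (hq : 2 ≤ q) (hq' : q ≤ 13)
    (χ : DirichletCharacter ℂ q) (hprim : χ.IsPrimitive) {n : ℕ} (hn : 4 ≤ n) (hn' : n ≤ 48) :
    2 / 3 * charLiTrend χ n < liCoeffCharRe χ n ∧ 0 < charLiTrend χ n := by
  have h3 := charLiTrend_gt_three_mul_abs_charLiOsc hq hq' χ hprim hn hn'
  have hsplit := liDirichletSplit_holds q χ hprim (by omega) n (by omega)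
  have habs := abs_nonneg (charLiOsc χ n)
  have hle := neg_abs_le (charLiOsc χ n)
  constructor
  · rw [hsplit]; linarith
  · linarith

/-! ## `n = 1`: the sign of the trend by parity (facts about `ψ`; `L`-free) -/

/-- A row with negative upper end. -/
theorem neg_of_inRow {y : ℝ} {d : ℕ} {l h : ℤ} (hy : InRow y d l h) (hh : h < 0) : y < 0 :=
  hy.2.trans_lt (div_neg_of_neg_of_pos (by exact_mod_cast hh) (by positivity))

/-- A row with positive lower end. -/
theorem pos_of_inRow {y : ℝ} {d : ℕ} {l h : ℤ} (hy : InRow y d l h) (hl : 0 < l) : 0 < y :=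
  lt_of_lt_of_le (div_pos (by exact_mod_cast hl) (by positivity)) hy.1

/-- **Even characters, `q ∈ {5, 7, 8, 9, 11, 12, 13}`: `lb_χ(1) < 0`** (`lb_χ(1) = ½ log(q/π) + ½ ψ(½) =
½ log(q/π) − γ/2 − log 2 < 0` iff `q < 4π e^γ ≈ 22.4`; read off row 1 of the certified trend tables).  Holds for EVERY
character of parity `0`, primitive or not (for `q = 3, 4` there is no even table: the even characters there are
principal); GRH-free and `L`-free. -/
theorem charLiTrend_one_neg_of_even {q : ℕ} [NeZero q]
    (hq : q = 5 ∨ q = 7 ∨ q = 8 ∨ q = 9 ∨ q = 11 ∨ q = 12 ∨ q = 13) (χ : DirichletCharacter ℂ q)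
    (hχ : charParity χ = 0) : charLiTrend χ 1 < 0 := by
  rcases hq with rfl | rfl | rfl | rfl | rfl | rfl | rfl
  · exact neg_of_inRow (charLiTrend_row_q5_even χ hχ (n := 1) le_rfl (by norm_num)) (by decide)
  · exact neg_of_inRow (charLiTrend_row_q7_even χ hχ (n := 1) le_rfl (by norm_num)) (by decide)
  · exact neg_of_inRow (charLiTrend_row_q8_even χ hχ (n := 1) le_rfl (by norm_num)) (by decide)
  · exact neg_of_inRow (charLiTrend_row_q9_even χ hχ (n := 1) le_rfl (by norm_num)) (by decide)
  · exact neg_of_inRow (charLiTrend_row_q11_even χ hχ (n := 1) le_rfl (by norm_num)) (by decide)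
  · exact neg_of_inRow (charLiTrend_row_q12_even χ hχ (n := 1) le_rfl (by norm_num)) (by decide)
  · exact neg_of_inRow (charLiTrend_row_q13_even χ hχ (n := 1) le_rfl (by norm_num)) (by decide)

/-- **Odd characters, `q ∈ {3, 4, 5}`: `lb_χ(1) < 0`** (`lb_χ(1) = ½ log(q/π) + ½ ψ(1) = ½ log(q/π) − γ/2 < 0` iff
`q < π e^γ ≈ 5.6`).  EVERY character of parity `1`; GRH-free and `L`-free. -/
theorem charLiTrend_one_neg_of_odd {q : ℕ} [NeZero q] (hq : q = 3 ∨ q = 4 ∨ q = 5) (χ : DirichletCharacter ℂ q)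
    (hχ : charParity χ = 1) : charLiTrend χ 1 < 0 := by
  rcases hq with rfl | rfl | rfl
  · exact neg_of_inRow (charLiTrend_row_q3_odd χ hχ (n := 1) le_rfl (by norm_num)) (by decide)
  · exact neg_of_inRow (charLiTrend_row_q4_odd χ hχ (n := 1) le_rfl (by norm_num)) (by decide)
  · exact neg_of_inRow (charLiTrend_row_q5_odd χ hχ (n := 1) le_rfl (by norm_num)) (by decide)

/-- **Odd characters, `q ∈ {7, 8, 9, 11, 13}`: `lb_χ(1) > 0`** (`q > π e^γ`).  EVERY character of parity `1`; GRH-free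
and `L`-free. -/
theorem charLiTrend_one_pos_of_odd {q : ℕ} [NeZero q] (hq : q = 7 ∨ q = 8 ∨ q = 9 ∨ q = 11 ∨ q = 13)
    (χ : DirichletCharacter ℂ q) (hχ : charParity χ = 1) : 0 < charLiTrend χ 1 := by
  rcases hq with rfl | rfl | rfl | rfl | rfl
  · exact pos_of_inRow (charLiTrend_row_q7_odd χ hχ (n := 1) le_rfl (by norm_num)) (by decide)
  · exact pos_of_inRow (charLiTrend_row_q8_odd χ hχ (n := 1) le_rfl (by norm_num)) (by decide)
  · exact pos_of_inRow (charLiTrend_row_q9_odd χ hχ (n := 1) le_rfl (by norm_num)) (by decide)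
  · exact pos_of_inRow (charLiTrend_row_q11_odd χ hχ (n := 1) le_rfl (by norm_num)) (by decide)
  · exact pos_of_inRow (charLiTrend_row_q13_odd χ hχ (n := 1) le_rfl (by norm_num)) (by decide)

/-- When the trend is negative, the first Li coefficient of a primitive character is ARITHMETIC-CARRIED:
`0 < Re λ_χ(1) < lt_χ(1) = Re (L′/L)(1, χ)`-functional (conductor `2 ≤ q ≤ 13`).  RH-FREE DATA. -/
theorem charLiOsc_one_gt_liCoeffCharRe_one_of_trend_neg {q : ℕ} [NeZero q] (hq : 2 ≤ q) (hq' : q ≤ 13)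
    (χ : DirichletCharacter ℂ q) (hprim : χ.IsPrimitive) (h : charLiTrend χ 1 < 0) :
    0 < liCoeffCharRe χ 1 ∧ liCoeffCharRe χ 1 < charLiOsc χ 1 := by
  have hsplit := liDirichletSplit_holds q χ hprim (by omega) 1 le_rfl
  exact ⟨liCoeffCharRe_pos_of_isPrimitive_le_13 hq hq' χ hprim le_rfl (by norm_num), by rw [hsplit]; linarith⟩

/-- **EVEN primitive characters of conductor `5 ≤ q ≤ 13` (16 of the 37): `lb_χ(1) < 0 < Re λ_χ(1) < lt_χ(1)`** — the
first Li coefficient is positive BECAUSE OF the arithmetic part.  RH-FREE DATA; nothing about GRH. -/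
theorem li_one_arithmetic_carried_of_even {q : ℕ} [NeZero q]
    (hq : q = 5 ∨ q = 7 ∨ q = 8 ∨ q = 9 ∨ q = 11 ∨ q = 12 ∨ q = 13) (χ : DirichletCharacter ℂ q)
    (hprim : χ.IsPrimitive) (hχ : charParity χ = 0) :
    charLiTrend χ 1 < 0 ∧ 0 < liCoeffCharRe χ 1 ∧ liCoeffCharRe χ 1 < charLiOsc χ 1 := by
  have h := charLiTrend_one_neg_of_even hq χ hχ
  exact ⟨h, charLiOsc_one_gt_liCoeffCharRe_one_of_trend_neg (by omega) (by omega) χ hprim h⟩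

/-- **ODD primitive characters of conductor `q ∈ {3, 4, 5}` (`3.2, 4.3, 5.2, 5.3`): `lb_χ(1) < 0 < Re λ_χ(1) < lt_χ(1)`.**
RH-FREE DATA; nothing about GRH. -/
theorem li_one_arithmetic_carried_of_odd {q : ℕ} [NeZero q] (hq : q = 3 ∨ q = 4 ∨ q = 5)
    (χ : DirichletCharacter ℂ q) (hprim : χ.IsPrimitive) (hχ : charParity χ = 1) :
    charLiTrend χ 1 < 0 ∧ 0 < liCoeffCharRe χ 1 ∧ liCoeffCharRe χ 1 < charLiOsc χ 1 := by
  have h := charLiTrend_one_neg_of_odd hq χ hχ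
  exact ⟨h, charLiOsc_one_gt_liCoeffCharRe_one_of_trend_neg (by omega) (by omega) χ hprim h⟩


/-! ## The SIGN MARGIN `m_χ(n) = Re λ_χ(n)/lb_χ(n)` on the certified range (D-0117 LI vocabulary)

The column's registered search question (director-rh, REQUESTS 2026-08-26T22:08:13Z (II) LI; eng-6 SPEC
`HOME/eng6/MARGIN-EXPERIMENT-SPEC.md`) asks for the law of the margin `m(n) = (lt_n + lb_n)/lb_n` and its universality
across `χ` on bands `n ≥ 10³`.  The kernel table settles the SMALL-`n` end for all 37 characters at once:
`|m_χ(n) − 1| = |lt_χ(n)|/lb_χ(n) < 1/3, 1/5, 1/10, 1/20` from `n = 4, 7, 17, 34` on (`n ≤ 48`; thresholds sharp for the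
table).  These rows say nothing about the bands `≥ 10³` of the registered kill test and are not a substitute for it. -/

/-- The `c = 20` dominance check from row `34`. -/
def dom20OK (rows : RowTable) : Bool :=
  (List.range 48).all fun i ↦ decide (i + 1 < 34) || domRow 20 (rowOf rows (i + 1))

/-- All 23 tables pass the `c = 20` check. -/
def allDom20OK : Bool := (List.range 14).all fun q ↦ (classRows q).all dom20OK

/-- Kernel evaluation. -/
theorem allDom20OK_true : allDom20OK = true := by decide +kernel

/-- **TREND DOMINANCE from `n = 34`**: `20·|lt_χ(n)| < lb_χ(n)` for every primitive character of conductor `2 ≤ q ≤ 13`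
and every `34 ≤ n ≤ 48` (fails at `n = 33`, `χ = 8.3`).  RH-FREE DATA; no `∀ n` claim. -/
theorem charLiTrend_gt_twenty_mul_abs_charLiOsc {q : ℕ} [NeZero q] (hq : 2 ≤ q) (hq' : q ≤ 13)
    (χ : DirichletCharacter ℂ q) (hprim : χ.IsPrimitive) {n : ℕ} (hn : 34 ≤ n) (hn' : n ≤ 48) :
    20 * |charLiOsc χ n| < charLiTrend χ n := by
  have hall := allDom20OK_true
  unfold allDom20OK at hall
  rw [List.all_eq_true] at hall
  have h := charLiTrend_gt_mul_abs_of_dom hq hq' χ hprim (c := 20) (by norm_num) (by omega) hn' fun rows hmem ↦ by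
    have h1 := hall q (List.mem_range.2 (by omega))
    rw [List.all_eq_true] at h1
    have h2 := h1 rows hmem
    unfold dom20OK at h2
    rw [List.all_eq_true] at h2
    have h3 := h2 (n - 1) (List.mem_range.2 (by omega))
    rw [show n - 1 + 1 = n by omega] at h3
    simp only [Bool.or_eq_true, decide_eq_true_eq] at h3
    exact h3.resolve_left (by omega)
  exact_mod_cast h

/-- **THE SIGN MARGIN IS WITHIN `1/3, 1/5, 1/10, 1/20` OF `1` from `n = 4, 7, 17, 34`** (difference form,
`Re λ_χ(n) − lb_χ(n) = lt_χ(n)`): for every primitive character of conductor `2 ≤ q ≤ 13` and `n ≤ 48`.  RH-FREE DATA;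
the `∀ n` margin positivity is GRH-EQUIVALENT and NOT claimed. -/
theorem abs_liCoeffCharRe_sub_charLiTrend_lt {q : ℕ} [NeZero q] (hq : 2 ≤ q) (hq' : q ≤ 13)
    (χ : DirichletCharacter ℂ q) (hprim : χ.IsPrimitive) {n : ℕ} (hn' : n ≤ 48) :
    (4 ≤ n → |liCoeffCharRe χ n - charLiTrend χ n| < charLiTrend χ n / 3) ∧
      (7 ≤ n → |liCoeffCharRe χ n - charLiTrend χ n| < charLiTrend χ n / 5) ∧
      (17 ≤ n → |liCoeffCharRe χ n - charLiTrend χ n| < charLiTrend χ n / 10) ∧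
      (34 ≤ n → |liCoeffCharRe χ n - charLiTrend χ n| < charLiTrend χ n / 20) := by
  have hsplit : ∀ {n : ℕ}, 1 ≤ n → liCoeffCharRe χ n - charLiTrend χ n = charLiOsc χ n := fun hn ↦ by
    rw [liDirichletSplit_holds q χ hprim (by omega) _ hn]; ring
  refine ⟨fun hn ↦ ?_, fun hn ↦ ?_, fun hn ↦ ?_, fun hn ↦ ?_⟩
  · rw [hsplit (by omega)]; have := charLiTrend_gt_three_mul_abs_charLiOsc hq hq' χ hprim hn hn'; linarith
  · rw [hsplit (by omega)]; have := charLiTrend_gt_five_mul_abs_charLiOsc hq hq' χ hprim hn hn'; linarith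
  · rw [hsplit (by omega)]; have := charLiTrend_gt_ten_mul_abs_charLiOsc hq hq' χ hprim hn hn'; linarith
  · rw [hsplit (by omega)]; have := charLiTrend_gt_twenty_mul_abs_charLiOsc hq hq' χ hprim hn hn'; linarith

/-- **Ratio form at the `10 %` level**: `|m_χ(n) − 1| < 1/10`, `m_χ(n) = Re λ_χ(n)/lb_χ(n)`, for every primitive character
of conductor `2 ≤ q ≤ 13` and every `17 ≤ n ≤ 48` — at the small-`n` end the margin is universal across the 37
characters at the `10 %` level (kernel-certified).  RH-FREE DATA; says nothing about the bands `n ≥ 10³` of the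
registered experiment; not evidence for GRH. -/
theorem abs_li_margin_sub_one_lt_tenth {q : ℕ} [NeZero q] (hq : 2 ≤ q) (hq' : q ≤ 13)
    (χ : DirichletCharacter ℂ q) (hprim : χ.IsPrimitive) {n : ℕ} (hn : 17 ≤ n) (hn' : n ≤ 48) :
    |liCoeffCharRe χ n / charLiTrend χ n - 1| < 1 / 10 := by
  have hpos : 0 < charLiTrend χ n := (liCoeffCharRe_pos_of_dominance hq hq' χ hprim (by omega) hn').2
  have h := (abs_liCoeffCharRe_sub_charLiTrend_lt hq hq' χ hprim hn').2.2.1 hn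
  rw [show liCoeffCharRe χ n / charLiTrend χ n - 1 = (liCoeffCharRe χ n - charLiTrend χ n) / charLiTrend χ n by
    field_simp, abs_div, abs_of_pos hpos, div_lt_iff₀ hpos]
  linarith

end Summit.RiemannHypothesis.RiemannHypothesis.Theorems.LiDirichletKernel
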